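import Mathlib.Topology.ContinuousMap.Weierstrass
import Literature.Computability.QuantumComplexity.SparseQSVTEstimation
import HarnessLib

/-!
# The even "rectangle" polynomial of Gharibian–Le Gall, Lemma 4, from sign polynomials

Gharibian, Le Gall, *Dequantizing the quantum singular value transformation: hardness and
applications to quantum chemistry and the quantum PCP conjecture*, STOC 2022 / SIAM J. Comput.
(arXiv:2111.09079), **§4.2, Lemma 4** — the polynomial that the formal version of Theorem 4
(`SparseQSVTEstimation.lean`, `singularValue_decision`) feeds to the estimator `EST`, there taken
as the hypotheses `hP01` / `hPin` / `hPout`.  As printed: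

> **Lemma 4.** For any `t₁, t₂, θ₁, θ₂ ∈ [0,1]` such that `θ₁ ≤ t₁ < t₂ ≤ 1 − θ₂` and any
> `χ ∈ (0,1)`, there exists an even polynomial `P ∈ ℝ[x]` of degree
> `O((1/θ₁ + 1/θ₂) log(1/χ))` such that `|P(x)| ≤ 1` for all `x ∈ [−1,1]` and:
> `P(x) ∈ [1−χ, 1]` if `x ∈ [t₁,t₂]`, `P(x) ∈ [0, χ]` if `x ∈ [0, t₁−θ₁] ∪ [t₂+θ₂, 1]`.
>
> *Proof.* Low and Chuang [Low+17] (see also Lemma 25 in [Gilyen+STOC19]) showed that for all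
> `η > 0`, `ξ ∈ (0,1/2)`, there exists an efficiently computable odd polynomial `P' ∈ ℝ[x]` of
> degree `O(log(1/ξ)/η)` such that: `P'(x) ∈ [−1,1]` for all `x ∈ [−2,2]`, `P'(x) ∈ [−1,−1+ξ]`
> if `x ∈ [−2,−η]`, `P'(x) ∈ [1−ξ,1]` if `x ∈ [η,2]`.  Let `P₁'` be the polynomial obtained by
> this construction with `η = θ₁/2` and `ξ = 2χ/5`, and `P₂'` … with `η = θ₂/2` and `ξ = 2χ/5`.
> Define `Q(x) = (1−ξ)·(P₁'(x−t₁+θ₁/2) + P₂'(−x+t₂+θ₂/2))/2 + ξ` [print: `P'` in both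
> positions, sic — `P₁'`, `P₂'` are meant]. … Finally, set
> `P(x) = (Q(x)+Q(−x))/(1+ξ)`.  (The lemma "can be considered as a variant of Lemma 29 in
> [Gilyen+STOC19]".)

What is formalized.  The cited sign polynomials are the HYPOTHESIS CLASS `SignApprox η ξ p`
(exactly the three displayed range conditions; [LowChuang2017], [GilyenEtAl2019, Lemma 25 of the
STOC version = Lemma 24 "Polynomial approximations of the sign function" of arXiv:1806.01838]; the
degree bound `O(log(1/ξ)/η)` is CITED, not proved — `SignApprox.exists_of_pos` only shows the
class is non-empty for every `η > 0`, `0 < ξ ≤ 1`, by Weierstrass approximation, with no degree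
bound; an EXPLICIT member with a PROVED degree bound `≤ 5·ln(16/(ηξ))/η + 5` — weaker than the
cited one by the `log(1/η)/η` term — is OUR construction in
`Summits/QuantumAdvantage/Dequantization/SignPolynomial.lean`, not a published statement).  From
any `p₁ ∈ SignApprox (θ₁/2) ξ`, `p₂ ∈ SignApprox (θ₂/2) ξ` we build `Q` (`windowQ`) and the even
`P` (`windowPoly`) and PROVE: `P(−X) = P` (`windowPoly_comp_neg_X`),
`deg P ≤ max(deg p₁, deg p₂)` (`natDegree_windowPoly_le` — so the printed degree is inherited from
the cited lemma), `P ∈ [0,1]` on `[−1,1]`, `P ≥ 1 − 2ξ` on `[t₁,t₂]`, `P ≤ 2ξ` on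
`[0,t₁−θ₁] ∪ [t₂+θ₂,1]`; with the printed `ξ = 2χ/5` this is Lemma 4 (`exists_windowPoly`,
ranges `[1−χ,1]` and `[0,χ]`).  The last section reads the even `P` as the coefficient vector
`a_k = coeff_{2k}(P)` of `SparseQSVTEstimation.evenPolyVal` (`evenPolyVal_evenCoeffs`) and
discharges the three Lemma-4 hypotheses of the in-tree Theorem 4 (`windowPoly_lemma4_hypotheses`,
`singularValue_decision_of_signApprox`): Theorem 4 (real case) now rests on the two Def.-2
oracles, `ζ`-sampling access, and two sign polynomials of the cited kind — nothing else.

Deviation from the printed proof (documented, not hidden).  The printed affine map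
`S ↦ (1−ξ)S/2 + ξ` (with `S = P₁'(·) + P₂'(·) ∈ [−ξ, ξ]` when the two sign polynomials are pinned
to opposite signs) gives `Q ∈ [ξ/2 + ξ²/2, 3ξ/2 − ξ²/2]` there — the paper's own second bullet
computes this correctly as `⊆ [0, 3ξ/2]`, but the sentence "`Q(x) ∈ [0,ξ]` for all `x ∈ [−1,0]`"
states `[0,ξ]` for the very same configuration, and the final normalisation `1/(1+ξ)` relies on
it: abstractly (for SOME values of `P₁'`, `P₂'` admitted by the three range conditions) the
printed `P` reaches `1 + ξ(1−ξ)/(2(1+ξ)) > 1` on `[t₁,t₂]` and `(3ξ−ξ²)/(1+ξ) > 5ξ/2 = χ`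
(for `ξ < 1/7`) on the outer region; see the `example` under "The arithmetic slip in the printed
normalisation" below for the numbers at `ξ = 1/10`.  (The same affine map appears in the
proof of [GilyenEtAl2019, Lemma 29] (arXiv:1806.01838 Lemma 28); by the same computation the
polynomial built there takes values up to `ε'(5−ε')/4 > ε'` on the outer region, against the
printed `[0, ε']` — immaterial for every
`O(·)` statement in either paper, but a formal proof has to use a map that works.)  We
therefore use the affine map `S ↦ (S + ξ)/(2 + ξ)` in `Q`; with it EVERY displayed inclusion of
the printed proof holds as printed (`Q ∈ [1−ξ,1]` on `[t₁,t₂]`, `Q ∈ [0,ξ] ⊆ [0,3ξ/2]` on the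
outer region and on `[−1,0]`, `Q ∈ [0,1]` on `[0,1]`), the final normalisation is the printed
`1/(1+ξ)`, the printed `ξ = 2χ/5` works, and the statement of Lemma 4 is obtained verbatim
(indeed with `P ∈ [0,1]` on `[−1,1]`, as the printed proof also gives).  Oddness of `P'` is not
used by the construction (neither in print nor here) and is not assumed.  Hypotheses are the
printed ones weakened where free: `0 ≤ θᵢ`, `θ₁ ≤ t₁ ≤ t₂ ≤ 1 − θ₂` (`<` not needed), `0 ≤ ξ`.
Real polynomials throughout (the lemma is a statement about `ℝ[x]`).  No named facts are
introduced; everything stated is proved.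

## References
* [GharibianLegall2022] S. Gharibian, F. Le Gall, STOC 2022, 19–32, doi:10.1145/3519935.3519991
  (arXiv:2111.09079, held as `paper:arxiv-2111.09079`: §4.2 Lemma 4 and its proof, chunks
  p0015–p0016; proof of Theorem 4, p0016).
* [GilyenEtAl2019] A. Gilyén, Y. Su, G. H. Low, N. Wiebe, STOC 2019, 193–204,
  doi:10.1145/3313276.3316366 (arXiv:1806.01838, held: Lemma 24 "Polynomial approximations of
  the sign function", Lemma 28 "… of the rectangle function" = Lemmas 25, 29 of the STOC text).
* [LowChuang2017] G. H. Low, I. L. Chuang, *Hamiltonian simulation by uniform spectral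
  amplification*, arXiv:1707.05391 (the constructive sign-function approximation).
-/

noncomputable section

namespace Literature.Computability.QuantumComplexity

namespace SampleQuery

open Polynomial Finset Matrix Literature.Computability.Complexity

/-! ### The hypothesis class: sign polynomials on `[−2,2] ∖ (−η, η)` -/

/-- **The Low–Chuang / GSLW sign polynomial, as used by GL22** — the three range conditions of the
display in the proof of Lemma 4: "`P'(x) ∈ [−1,1]` for all `x ∈ [−2,2]`, `P'(x) ∈ [−1,−1+ξ]` if
`x ∈ [−2,−η]`, `P'(x) ∈ [1−ξ,1]` if `x ∈ [η,2]`" (GSLW: "for all `x ∈ [−2,2]`: `|P(x)| ≤ 1`, and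
for all `x ∈ [−2,2] ∖ (−δ,δ)`: `|P(x) − sign(x)| ≤ ε`").  The published content beyond these
conditions — "an efficiently computable odd polynomial … of degree `O(log(1/ξ)/η)`" — is cited,
not formalized: a user supplies `p` together with whatever degree bound the source gives.
[cite: GharibianLegall2022, §4.2 proof of Lemma 4 (first display)];
[cite: GilyenEtAl2019, Lemma 25 (arXiv:1806.01838 Lemma 24)]; [cite: LowChuang2017] -/
structure SignApprox (η ξ : ℝ) (p : ℝ[X]) : Prop where
  /-- `P'(x) ∈ [−1,1]` on `[−2,2]`. -/
  abs_le : ∀ x : ℝ, -2 ≤ x → x ≤ 2 → |p.eval x| ≤ 1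
  /-- `P'(x) ≤ −1 + ξ` on `[−2,−η]`. -/
  le_on_neg : ∀ x : ℝ, -2 ≤ x → x ≤ -η → p.eval x ≤ -1 + ξ
  /-- `P'(x) ≥ 1 − ξ` on `[η,2]`. -/
  ge_on_pos : ∀ x : ℝ, η ≤ x → x ≤ 2 → 1 - ξ ≤ p.eval x

namespace SignApprox

variable {η ξ : ℝ} {p : ℝ[X]}

/-- Lower bound `−1 ≤ P'(x)` on `[−2,2]`. [cite: GharibianLegall2022, §4.2 proof of Lemma 4] -/
theorem neg_one_le (h : SignApprox η ξ p) {x : ℝ} (h1 : -2 ≤ x) (h2 : x ≤ 2) :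
    -1 ≤ p.eval x :=
  (_root_.abs_le.mp (h.abs_le x h1 h2)).1

/-- Upper bound `P'(x) ≤ 1` on `[−2,2]`. [cite: GharibianLegall2022, §4.2 proof of Lemma 4] -/
theorem le_one (h : SignApprox η ξ p) {x : ℝ} (h1 : -2 ≤ x) (h2 : x ≤ 2) : p.eval x ≤ 1 :=
  (_root_.abs_le.mp (h.abs_le x h1 h2)).2

/-- **Non-vacuity (existence WITHOUT the degree bound).**  For every `η > 0` and `0 < ξ ≤ 1` some
real polynomial satisfies the three conditions: Weierstrass-approximate the continuous odd ramp
`x ↦ (1 − ξ/2)·clamp(x/η, −1, 1)` to within `ξ/2` on `[−2,2]`.  This is only the trivial part of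
the cited result — [LowChuang2017] / [GilyenEtAl2019, Lemma 25] give an explicit odd polynomial
of degree `O(log(1/ξ)/η)`, which is what makes Lemma 4's degree `O((1/θ₁+1/θ₂)log(1/χ))`; that
bound is not formalized here (an explicit member of degree `≤ 5·ln(16/(ηξ))/η + 5`, our own
construction, is `Summits/QuantumAdvantage/Dequantization/SignPolynomial.lean`,
`exists_signApprox_natDegree_le`).
[cite: GilyenEtAl2019, Lemma 25 (existence part only; arXiv:1806.01838 Lemma 24)] -/
theorem exists_of_pos (hη : 0 < η) (hξ : 0 < ξ) (hξ1 : ξ ≤ 1) : ∃ p : ℝ[X], SignApprox η ξ p := by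
  set f : ℝ → ℝ := fun x => (1 - ξ / 2) * max (-1) (min 1 (x / η)) with hf_def
  have hf : ContinuousOn f (Set.Icc (-2) 2) := by
    refine Continuous.continuousOn ?_
    exact continuous_const.mul
      (continuous_const.max (continuous_const.min (continuous_id.div_const η)))
  obtain ⟨p, hp⟩ := exists_polynomial_near_of_continuousOn (-2) 2 f hf (ξ / 2) (by linarith)
  have hclamp : ∀ x : ℝ, |max (-1 : ℝ) (min 1 (x / η))| ≤ 1 := fun x =>
    _root_.abs_le.mpr ⟨le_max_left _ _, max_le (by norm_num) (min_le_left _ _)⟩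
  refine ⟨p, ⟨?_, ?_, ?_⟩⟩
  · intro x h1 h2
    have hpx := (hp x ⟨h1, h2⟩).le
    have hfx : |f x| ≤ 1 - ξ / 2 := by
      rw [hf_def, abs_mul, abs_of_nonneg (by linarith : (0 : ℝ) ≤ 1 - ξ / 2)]
      have := hclamp x
      nlinarith
    calc |p.eval x| = |(p.eval x - f x) + f x| := by ring_nf
      _ ≤ |p.eval x - f x| + |f x| := abs_add_le _ _
      _ ≤ ξ / 2 + (1 - ξ / 2) := add_le_add hpx hfx
      _ = 1 := by ring
  · intro x h1 h2
    have hx2 : x ≤ 2 := by linarith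
    have hpx := (abs_lt.mp (hp x ⟨h1, hx2⟩)).2
    have hq : x / η ≤ -1 := by rw [div_le_iff₀ hη]; linarith
    have hfx : f x = -(1 - ξ / 2) := by
      rw [hf_def]
      dsimp only
      rw [min_eq_right (by linarith : x / η ≤ 1), max_eq_left hq]
      ring
    linarith
  · intro x h1 h2
    have hx1 : -2 ≤ x := by linarith
    have hpx := (abs_lt.mp (hp x ⟨hx1, h2⟩)).1
    have hq : 1 ≤ x / η := by rw [le_div_iff₀ hη]; linarith
    have hfx : f x = 1 - ξ / 2 := by
      rw [hf_def]
      dsimp only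
      rw [min_eq_left hq, max_eq_right (by norm_num : (-1 : ℝ) ≤ 1)]
      ring
    linarith

end SignApprox

/-! ### The construction: `Q` and the even `P` -/

section construction

variable (t₁ t₂ θ₁ θ₂ ξ : ℝ) (p₁ p₂ : ℝ[X])

/-- **`Q`** of the proof of Lemma 4, with the corrected affine map (module docstring):
`Q(x) = (P₁'(x − t₁ + θ₁/2) + P₂'(−x + t₂ + θ₂/2) + ξ)/(2 + ξ)` — in print
`(1−ξ)(P'(x−t₁+θ₁/2) + P'(−x+t₂+θ₂/2))/2 + ξ` [sic: `P'` twice; `P₁'`, `P₂'` are meant].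
[cite: GharibianLegall2022, §4.2 proof of Lemma 4 (definition of `Q`)] -/
def windowQ : ℝ[X] :=
  C (1 / (2 + ξ)) * (p₁.comp (X - C (t₁ - θ₁ / 2)) + p₂.comp (C (t₂ + θ₂ / 2) - X) + C ξ)

/-- **`P(x) = (Q(x) + Q(−x))/(1+ξ)`**, "an even polynomial".
[cite: GharibianLegall2022, §4.2 proof of Lemma 4 ("Finally, set `P(x) = (Q(x)+Q(−x))/(1+ξ)`")] -/
def windowPoly : ℝ[X] :=
  C (1 / (1 + ξ)) *
    (windowQ t₁ t₂ θ₁ θ₂ ξ p₁ p₂ + (windowQ t₁ t₂ θ₁ θ₂ ξ p₁ p₂).comp (-X))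

/-- Pointwise value of `Q`. [cite: GharibianLegall2022, §4.2 proof of Lemma 4] -/
theorem eval_windowQ (x : ℝ) :
    (windowQ t₁ t₂ θ₁ θ₂ ξ p₁ p₂).eval x =
      (p₁.eval (x - (t₁ - θ₁ / 2)) + p₂.eval (t₂ + θ₂ / 2 - x) + ξ) / (2 + ξ) := by
  simp only [windowQ, eval_mul, eval_C, eval_add, eval_comp, eval_sub, eval_X]
  ring

/-- Pointwise value of `P`. [cite: GharibianLegall2022, §4.2 proof of Lemma 4] -/
theorem eval_windowPoly (x : ℝ) :
    (windowPoly t₁ t₂ θ₁ θ₂ ξ p₁ p₂).eval x =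
      ((windowQ t₁ t₂ θ₁ θ₂ ξ p₁ p₂).eval x + (windowQ t₁ t₂ θ₁ θ₂ ξ p₁ p₂).eval (-x)) /
        (1 + ξ) := by
  simp only [windowPoly, eval_mul, eval_C, eval_add, eval_comp, eval_neg, eval_X]
  ring

/-- **`P` is even**: `P(−X) = P`. [cite: GharibianLegall2022, §4.2 Lemma 4 ("an even
polynomial") and its proof ("This is an even polynomial")] -/
theorem windowPoly_comp_neg_X :
    (windowPoly t₁ t₂ θ₁ θ₂ ξ p₁ p₂).comp (-X) = windowPoly t₁ t₂ θ₁ θ₂ ξ p₁ p₂ := by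
  simp only [windowPoly, mul_comp, C_comp, add_comp, comp_assoc, neg_comp, X_comp, neg_neg,
    comp_X]
  ring

/-- `deg Q ≤ max(deg P₁', deg P₂')` (composition with the two affine maps `x ↦ x − t₁ + θ₁/2`,
`x ↦ −x + t₂ + θ₂/2`). [cite: GharibianLegall2022, §4.2 proof of Lemma 4 (degree count)] -/
theorem natDegree_windowQ_le :
    (windowQ t₁ t₂ θ₁ θ₂ ξ p₁ p₂).natDegree ≤ max p₁.natDegree p₂.natDegree := by
  unfold windowQ
  refine (natDegree_C_mul_le _ _).trans ?_
  refine (natDegree_add_le _ _).trans (max_le ((natDegree_add_le _ _).trans (max_le ?_ ?_)) ?_)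
  · refine natDegree_comp_le.trans ?_
    rw [natDegree_X_sub_C, mul_one]
    exact le_max_left _ _
  · refine natDegree_comp_le.trans ?_
    have h1 : (C (t₂ + θ₂ / 2) - X : ℝ[X]).natDegree = 1 := by
      rw [← neg_sub, natDegree_neg, natDegree_X_sub_C]
    rw [h1, mul_one]
    exact le_max_right _ _
  · rw [natDegree_C]
    exact Nat.zero_le _

/-- **Degree of `P`**: `deg P ≤ max(deg P₁', deg P₂')` — with the cited degrees
`O(log(1/ξ)/θᵢ)` this is the printed `O((1/θ₁ + 1/θ₂) log(1/χ))`.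
[cite: GharibianLegall2022, §4.2 Lemma 4 (degree) and its proof ("This is an even polynomial of
degree `O((1/θ₁+1/θ₂)log(1/χ))`")] -/
theorem natDegree_windowPoly_le :
    (windowPoly t₁ t₂ θ₁ θ₂ ξ p₁ p₂).natDegree ≤ max p₁.natDegree p₂.natDegree := by
  have hQ := natDegree_windowQ_le t₁ t₂ θ₁ θ₂ ξ p₁ p₂
  unfold windowPoly
  refine (natDegree_C_mul_le _ _).trans ((natDegree_add_le _ _).trans (max_le hQ ?_))
  refine natDegree_comp_le.trans ?_
  calc (windowQ t₁ t₂ θ₁ θ₂ ξ p₁ p₂).natDegree * (-X : ℝ[X]).natDegree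
      ≤ (windowQ t₁ t₂ θ₁ θ₂ ξ p₁ p₂).natDegree * 1 :=
        Nat.mul_le_mul_left _ (by rw [natDegree_neg]; exact natDegree_X_le)
    _ ≤ max p₁.natDegree p₂.natDegree := by rw [mul_one]; exact hQ

end construction

/-! ### The arithmetic slip in the printed normalisation (value level) -/

/-- With `ξ = 1/10` and the admissible values `P₁' = −1 + ξ`, `P₂' = 1` (the configuration of any
`x ∈ [−1,0]`), the PRINTED `Q = (1−ξ)(P₁'+P₂')/2 + ξ` equals `29/200 > ξ` (the text states
`Q ∈ [0,ξ]` there), and with `Q(x) = 1` (admissible on `[t₁,t₂]`) the printed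
`P = (Q(x)+Q(−x))/(1+ξ) = 229/220 > 1`; on the outer region both `Q(x)` and `Q(−x)` may equal
`29/200`, giving the printed `P = 29/110 > 1/4 = 5ξ/2 = χ`.  Hence the corrected affine map in
`windowQ`.
[cite: GharibianLegall2022, §4.2 proof of Lemma 4 ("`Q(x) ∈ [0,ξ]` for all `x ∈ [−1,0]`")] -/
example :
    (1 - (1 / 10 : ℝ)) * ((-1 + 1 / 10) + 1) / 2 + 1 / 10 = 29 / 200 ∧
      (1 / 10 : ℝ) < 29 / 200 ∧ (1 : ℝ) < (1 + 29 / 200) / (1 + 1 / 10) ∧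
      (29 / 200 + 29 / 200) / (1 + 1 / 10) = (29 / 110 : ℝ) ∧
      5 * (1 / 10 : ℝ) / 2 < 29 / 110 := by
  norm_num

/-! ### The range properties (the bullets of the printed proof) -/

/-- The standing hypotheses of Lemma 4 together with the two cited sign polynomials
(`η = θ₁/2` and `η = θ₂/2`, common `ξ`): "`t₁,t₂,θ₁,θ₂ ∈ [0,1]` such that
`θ₁ ≤ t₁ < t₂ ≤ 1−θ₂`" (here `t₁ ≤ t₂` suffices) and `ξ ≥ 0`.
[cite: GharibianLegall2022, §4.2 Lemma 4 (hypotheses) and its proof ("Let `P₁'` be the polynomial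
obtained by this construction with `η = θ₁/2` … and `P₂'` … with `η = θ₂/2`")] -/
structure WindowHyp (t₁ t₂ θ₁ θ₂ ξ : ℝ) (p₁ p₂ : ℝ[X]) : Prop where
  /-- `0 ≤ θ₁`. -/
  hθ₁ : 0 ≤ θ₁
  /-- `0 ≤ θ₂`. -/
  hθ₂ : 0 ≤ θ₂
  /-- `θ₁ ≤ t₁`. -/
  ht₁ : θ₁ ≤ t₁
  /-- `t₁ ≤ t₂` (printed: `t₁ < t₂`). -/
  ht₁₂ : t₁ ≤ t₂
  /-- `t₂ ≤ 1 − θ₂`. -/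
  ht₂ : t₂ ≤ 1 - θ₂
  /-- `0 ≤ ξ`. -/
  hξ : 0 ≤ ξ
  /-- `P₁'`: sign polynomial with `η = θ₁/2`. -/
  h₁ : SignApprox (θ₁ / 2) ξ p₁
  /-- `P₂'`: sign polynomial with `η = θ₂/2`. -/
  h₂ : SignApprox (θ₂ / 2) ξ p₂

namespace WindowHyp

variable {t₁ t₂ θ₁ θ₂ ξ : ℝ} {p₁ p₂ : ℝ[X]} (H : WindowHyp t₁ t₂ θ₁ θ₂ ξ p₁ p₂)
include H

/-- For `x ∈ [−1,1]` both arguments `x − t₁ + θ₁/2` and `−x + t₂ + θ₂/2` lie in `[−2,2]`, so both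
sign polynomials are bounded by `1` in absolute value there.
[cite: GharibianLegall2022, §4.2 proof of Lemma 4] -/
theorem args_mem {x : ℝ} (hx1 : -1 ≤ x) (hx2 : x ≤ 1) :
    (-2 ≤ x - (t₁ - θ₁ / 2) ∧ x - (t₁ - θ₁ / 2) ≤ 2) ∧
      (-2 ≤ t₂ + θ₂ / 2 - x ∧ t₂ + θ₂ / 2 - x ≤ 2) := by
  have := H.hθ₁; have := H.hθ₂; have := H.ht₁; have := H.ht₁₂; have := H.ht₂
  exact ⟨⟨by linarith, by linarith⟩, ⟨by linarith, by linarith⟩⟩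

/-- **`Q(x) ∈ [0,1]` for all `x ∈ [−1,1]`** ("it can be checked that `Q(x) ∈ [0,1]` for all
`x ∈ [0,1]`", and the lower bound of "`Q(x) ∈ [0,ξ]` for all `x ∈ [−1,0]`"): for `x ≤ t₂` the
second polynomial is pinned near `+1`, for `x ≥ t₁` the first one is, so the sum is `≥ −ξ`.
[cite: GharibianLegall2022, §4.2 proof of Lemma 4] -/
theorem windowQ_mem_Icc {x : ℝ} (hx1 : -1 ≤ x) (hx2 : x ≤ 1) :
    0 ≤ (windowQ t₁ t₂ θ₁ θ₂ ξ p₁ p₂).eval x ∧ (windowQ t₁ t₂ θ₁ θ₂ ξ p₁ p₂).eval x ≤ 1 := by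
  obtain ⟨⟨ha1, ha2⟩, ⟨hb1, hb2⟩⟩ := H.args_mem hx1 hx2
  have hξ := H.hξ
  have hpos : 0 < 2 + ξ := by linarith
  have hA1 := H.h₁.neg_one_le ha1 ha2
  have hA2 := H.h₁.le_one ha1 ha2
  have hB1 := H.h₂.neg_one_le hb1 hb2
  have hB2 := H.h₂.le_one hb1 hb2
  have hsum : -ξ ≤ p₁.eval (x - (t₁ - θ₁ / 2)) + p₂.eval (t₂ + θ₂ / 2 - x) := by
    rcases le_or_gt x t₂ with hxt | hxt
    · have := H.h₂.ge_on_pos (t₂ + θ₂ / 2 - x) (by linarith) hb2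
      linarith
    · have := H.h₁.ge_on_pos (x - (t₁ - θ₁ / 2)) (by linarith [H.ht₁₂, H.hθ₁]) ha2
      linarith
  rw [eval_windowQ]
  exact ⟨div_nonneg (by linarith) hpos.le, by rw [div_le_one hpos]; linarith⟩

/-- **First bullet: `Q(x) ∈ [1−ξ, 1]` for `x ∈ [t₁,t₂]`** — both sign polynomials are pinned
near `+1` (`x − t₁ + θ₁/2 ≥ θ₁/2`, `−x + t₂ + θ₂/2 ≥ θ₂/2`); precisely `Q ≥ (2−ξ)/(2+ξ) ≥ 1−ξ`.
[cite: GharibianLegall2022, §4.2 proof of Lemma 4 (first bullet)] -/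
theorem windowQ_ge_of_mem {x : ℝ} (hx1 : t₁ ≤ x) (hx2 : x ≤ t₂) :
    1 - ξ ≤ (windowQ t₁ t₂ θ₁ θ₂ ξ p₁ p₂).eval x := by
  have := H.hθ₁; have := H.hθ₂; have := H.ht₁; have := H.ht₂; have hξ := H.hξ
  obtain ⟨⟨_, ha2⟩, ⟨_, hb2⟩⟩ := H.args_mem (x := x) (by linarith) (by linarith)
  have hA := H.h₁.ge_on_pos (x - (t₁ - θ₁ / 2)) (by linarith) ha2
  have hB := H.h₂.ge_on_pos (t₂ + θ₂ / 2 - x) (by linarith) hb2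
  have hpos : 0 < 2 + ξ := by linarith
  rw [eval_windowQ, le_div_iff₀ hpos]
  nlinarith

/-- **Second bullet and the `[−1,0]` clause: `Q(x) ∈ [0, ξ]` for `x ∈ [−1, t₁−θ₁]`** (covering
the printed "`x ∈ [0,t₁−θ₁]`" and "`x ∈ [−1,0]`", since `0 ≤ t₁ − θ₁`): the first polynomial is
pinned near `−1`, the second near `+1`, so their sum lies in `[−ξ, ξ]`; with the corrected affine
map `Q ≤ 2ξ/(2+ξ) ≤ ξ` (printed bound for the outer region: `3ξ/2`).
[cite: GharibianLegall2022, §4.2 proof of Lemma 4 (second bullet; "`Q(x) ∈ [0,ξ]` for all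
`x ∈ [−1,0]`")] -/
theorem windowQ_le_of_le {x : ℝ} (hx1 : -1 ≤ x) (hx2 : x ≤ t₁ - θ₁) :
    (windowQ t₁ t₂ θ₁ θ₂ ξ p₁ p₂).eval x ≤ ξ := by
  have := H.hθ₁; have := H.hθ₂; have := H.ht₁; have := H.ht₁₂; have := H.ht₂; have hξ := H.hξ
  obtain ⟨⟨ha1, _⟩, ⟨_, hb2⟩⟩ := H.args_mem (x := x) hx1 (by linarith)
  have hA := H.h₁.le_on_neg (x - (t₁ - θ₁ / 2)) ha1 (by linarith)
  have hB := H.h₂.le_one (x := t₂ + θ₂ / 2 - x) (by linarith) hb2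
  have hpos : 0 < 2 + ξ := by linarith
  rw [eval_windowQ, div_le_iff₀ hpos]
  nlinarith

/-- **Second bullet, right part: `Q(x) ∈ [0, ξ]` for `x ∈ [t₂+θ₂, 1]`** (first polynomial pinned
near `+1`, second near `−1`). [cite: GharibianLegall2022, §4.2 proof of Lemma 4 (second bullet)] -/
theorem windowQ_le_of_ge {x : ℝ} (hx1 : t₂ + θ₂ ≤ x) (hx2 : x ≤ 1) :
    (windowQ t₁ t₂ θ₁ θ₂ ξ p₁ p₂).eval x ≤ ξ := by
  have := H.hθ₁; have := H.hθ₂; have := H.ht₁; have := H.ht₁₂; have := H.ht₂; have hξ := H.hξ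
  obtain ⟨⟨ha1, ha2⟩, ⟨hb1, _⟩⟩ := H.args_mem (x := x) (by linarith) hx2
  have hA := H.h₁.le_one (x := x - (t₁ - θ₁ / 2)) ha1 ha2
  have hB := H.h₂.le_on_neg (t₂ + θ₂ / 2 - x) hb1 (by linarith)
  have hpos : 0 < 2 + ξ := by linarith
  rw [eval_windowQ, div_le_iff₀ hpos]
  nlinarith

/-- **`P(x) ∈ [0,1]` for all `x ∈ [−1,1]`** (first conclusion of Lemma 4: "`|P(x)| ≤ 1` for all
`x ∈ [−1,1]`"; the proof's first bullet gives `[0,1]`): one of `x`, `−x` lies in `[−1,0]` where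
`Q ≤ ξ`, the other has `Q ≤ 1`, so `Q(x)+Q(−x) ≤ 1+ξ`.
[cite: GharibianLegall2022, §4.2 Lemma 4 and its proof ("`P(x) ∈ [0,1]` for all `x ∈ [−1,1]`")] -/
theorem windowPoly_mem_Icc {x : ℝ} (hx1 : -1 ≤ x) (hx2 : x ≤ 1) :
    0 ≤ (windowPoly t₁ t₂ θ₁ θ₂ ξ p₁ p₂).eval x ∧
      (windowPoly t₁ t₂ θ₁ θ₂ ξ p₁ p₂).eval x ≤ 1 := by
  have hξ := H.hξ
  have h1pos : 0 < 1 + ξ := by linarith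
  obtain ⟨hQ0, hQ1⟩ := H.windowQ_mem_Icc hx1 hx2
  obtain ⟨hQ0', hQ1'⟩ := H.windowQ_mem_Icc (x := -x) (by linarith) (by linarith)
  have ht : 0 ≤ t₁ - θ₁ := by linarith [H.ht₁]
  have hsum : (windowQ t₁ t₂ θ₁ θ₂ ξ p₁ p₂).eval x +
      (windowQ t₁ t₂ θ₁ θ₂ ξ p₁ p₂).eval (-x) ≤ 1 + ξ := by
    rcases le_or_gt x 0 with hx | hx
    · have := H.windowQ_le_of_le hx1 (by linarith)
      linarith
    · have := H.windowQ_le_of_le (x := -x) (by linarith) (by linarith)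
      linarith
  rw [eval_windowPoly]
  exact ⟨div_nonneg (by linarith) h1pos.le, by rw [div_le_one h1pos]; linarith⟩

/-- **`P(x) ≥ 1 − 2ξ` for `x ∈ [t₁,t₂]`** (second conclusion: "`P(x) ∈ [(1−ξ+0)/(1+ξ), 1]
⊆ [1−2ξ, 1]`"). [cite: GharibianLegall2022, §4.2 Lemma 4 and its proof (second bullet of the
final list)] -/
theorem windowPoly_ge_of_mem {x : ℝ} (hx1 : t₁ ≤ x) (hx2 : x ≤ t₂) :
    1 - 2 * ξ ≤ (windowPoly t₁ t₂ θ₁ θ₂ ξ p₁ p₂).eval x := by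
  have := H.hθ₁; have := H.hθ₂; have := H.ht₁; have := H.ht₂; have hξ := H.hξ
  have h1pos : 0 < 1 + ξ := by linarith
  have hQ := H.windowQ_ge_of_mem hx1 hx2
  have hQ' := (H.windowQ_mem_Icc (x := -x) (by linarith) (by linarith)).1
  have hmul : (1 - 2 * ξ) * (1 + ξ) ≤ 1 - ξ := by nlinarith [sq_nonneg ξ]
  rw [eval_windowPoly, le_div_iff₀ h1pos]
  linarith

/-- **`P(x) ≤ 2ξ` for `x ∈ [0, t₁−θ₁] ∪ [t₂+θ₂, 1]`** (third conclusion: "`P(x) ∈ [0,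
(3ξ/2+ξ)/(1+ξ)] ⊆ [0, 5ξ/2]`"; with the corrected `Q` both `Q(x)` and `Q(−x)` are `≤ ξ`).
[cite: GharibianLegall2022, §4.2 Lemma 4 and its proof (third bullet of the final list)] -/
theorem windowPoly_le_of_out {x : ℝ}
    (hx : (0 ≤ x ∧ x ≤ t₁ - θ₁) ∨ (t₂ + θ₂ ≤ x ∧ x ≤ 1)) :
    (windowPoly t₁ t₂ θ₁ θ₂ ξ p₁ p₂).eval x ≤ 2 * ξ := by
  have := H.hθ₁; have := H.hθ₂; have := H.ht₁; have := H.ht₁₂; have := H.ht₂; have hξ := H.hξ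
  have h1pos : 0 < 1 + ξ := by linarith
  have hx0 : 0 ≤ x := by rcases hx with h | h <;> linarith [h.1]
  have hx1 : x ≤ 1 := by rcases hx with h | h <;> linarith [h.2]
  have hQ : (windowQ t₁ t₂ θ₁ θ₂ ξ p₁ p₂).eval x ≤ ξ := by
    rcases hx with ⟨h0, h1⟩ | ⟨h0, h1⟩
    · exact H.windowQ_le_of_le (by linarith) h1
    · exact H.windowQ_le_of_ge h0 h1
  have hQ' : (windowQ t₁ t₂ θ₁ θ₂ ξ p₁ p₂).eval (-x) ≤ ξ :=
    H.windowQ_le_of_le (x := -x) (by linarith) (by linarith)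
  rw [eval_windowPoly, div_le_iff₀ h1pos]
  nlinarith

end WindowHyp

/-! ### Lemma 4 assembled (printed `ξ = 2χ/5`) -/

/-- **GL22 Lemma 4 (modulo the cited sign polynomials).**  Given `θ₁ ≤ t₁ ≤ t₂ ≤ 1−θ₂`
(`θᵢ ≥ 0`), `χ ≥ 0`, and two sign polynomials `P₁' ∈ SignApprox(θ₁/2, 2χ/5)`,
`P₂' ∈ SignApprox(θ₂/2, 2χ/5)` (as [LowChuang2017] / [GilyenEtAl2019, Lemma 25] provide, of
degrees `O(log(1/χ)/θᵢ)`), there is an even real polynomial `P` of degree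
`≤ max(deg P₁', deg P₂')` with `P(x) ∈ [0,1]` (so `|P(x)| ≤ 1`) for all `x ∈ [−1,1]`,
`P(x) ∈ [1−χ,1]` for `x ∈ [t₁,t₂]`, and `P(x) ∈ [0,χ]` for `x ∈ [0,t₁−θ₁] ∪ [t₂+θ₂,1]` — namely
`windowPoly t₁ t₂ θ₁ θ₂ (2χ/5) P₁' P₂'`.
[cite: GharibianLegall2022, §4.2 Lemma 4 (statement) and its proof (`ξ = 2χ/5`)] -/
theorem exists_windowPoly {t₁ t₂ θ₁ θ₂ χ : ℝ} {p₁ p₂ : ℝ[X]}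
    (H : WindowHyp t₁ t₂ θ₁ θ₂ (2 * χ / 5) p₁ p₂) :
    ∃ P : ℝ[X], P.comp (-X) = P ∧ P.natDegree ≤ max p₁.natDegree p₂.natDegree ∧
      (∀ x : ℝ, -1 ≤ x → x ≤ 1 → 0 ≤ P.eval x ∧ P.eval x ≤ 1) ∧
      (∀ x : ℝ, t₁ ≤ x → x ≤ t₂ → 1 - χ ≤ P.eval x ∧ P.eval x ≤ 1) ∧
      (∀ x : ℝ, (0 ≤ x ∧ x ≤ t₁ - θ₁) ∨ (t₂ + θ₂ ≤ x ∧ x ≤ 1) →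
        0 ≤ P.eval x ∧ P.eval x ≤ χ) := by
  have hξ : 0 ≤ 2 * χ / 5 := H.hξ
  have := H.hθ₁; have := H.hθ₂; have := H.ht₁; have := H.ht₁₂; have := H.ht₂
  refine ⟨windowPoly t₁ t₂ θ₁ θ₂ (2 * χ / 5) p₁ p₂, windowPoly_comp_neg_X _ _ _ _ _ _ _,
    natDegree_windowPoly_le _ _ _ _ _ _ _, fun x hx1 hx2 => H.windowPoly_mem_Icc hx1 hx2,
    fun x hx1 hx2 => ⟨?_, (H.windowPoly_mem_Icc (by linarith) (by linarith)).2⟩,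
    fun x hx => ⟨(H.windowPoly_mem_Icc (by rcases hx with h | h <;> linarith [h.1])
      (by rcases hx with h | h <;> linarith [h.2])).1, ?_⟩⟩
  · have := H.windowPoly_ge_of_mem hx1 hx2
    linarith
  · have := H.windowPoly_le_of_out hx
    linarith

/-! ### Reading the even `P` as the coefficient vector of Theorem 4 (`evenPolyVal`) -/

/-- Coefficients of `p(−X)`: `coeff_i (p ∘ (−X)) = (−1)^i coeff_i p`. [folklore] -/
private theorem coeff_comp_neg_X' (p : ℝ[X]) (i : ℕ) :
    (p.comp (-X)).coeff i = (-1) ^ i * p.coeff i := by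
  have hp : p.comp (-X) =
      ∑ j ∈ range (p.natDegree + 1), Polynomial.C (p.coeff j * (-1) ^ j) * X ^ j := by
    conv_lhs => rw [p.as_sum_range_C_mul_X_pow]
    rw [Polynomial.sum_comp]
    refine Finset.sum_congr rfl fun j _ => ?_
    rw [mul_comp, C_comp, X_pow_comp, neg_pow, ← mul_assoc, C_mul, C_pow, C_neg, C_1]
  rw [hp, finsetSum_coeff]
  simp only [coeff_C_mul_X_pow]
  rw [Finset.sum_eq_single i]
  · simp only [if_true]
    by_cases hi : i ∈ range (p.natDegree + 1)
    · ring
    · have h0 : p.coeff i = 0 := by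
        refine coeff_eq_zero_of_natDegree_lt ?_
        have := Finset.mem_range.not.1 hi
        omega
      simp [h0]
  · intro j _ hj
    simp [Ne.symm hj]
  · intro hi
    have h0 : p.coeff i = 0 := by
      refine coeff_eq_zero_of_natDegree_lt ?_
      have := Finset.mem_range.not.1 hi
      omega
    simp [h0]

/-- An even polynomial has no odd coefficients. [folklore] -/
private theorem coeff_odd_eq_zero {p : ℝ[X]} (hp : p.comp (-X) = p) (k : ℕ) :
    p.coeff (2 * k + 1) = 0 := by
  have h := congrArg (fun q : ℝ[X] => q.coeff (2 * k + 1)) hp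
  simp only [coeff_comp_neg_X', (show Odd (2 * k + 1) from ⟨k, rfl⟩).neg_one_pow,
    neg_one_mul] at h
  linarith

/-- Splitting a sum over `range (2n)` into even and odd indices. [folklore] -/
private theorem sum_range_two_mul (f : ℕ → ℝ) (n : ℕ) :
    ∑ i ∈ range (2 * n), f i = ∑ k ∈ range n, (f (2 * k) + f (2 * k + 1)) := by
  induction n with
  | zero => simp
  | succ n ih =>
    rw [show 2 * (n + 1) = 2 * n + 1 + 1 by ring, sum_range_succ, sum_range_succ, ih,
      sum_range_succ]
    ring

/-- **The coefficient vector `a_k = coeff_{2k}(P)`, `k ≤ d`**, of an even polynomial — the data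
`(a_0, a_2, …, a_{2d})` in which Theorem 3 / Theorem 4 receive "`P = a_0 + a_2x² + ⋯ + a_{2d}x^{2d}`".
[cite: GharibianLegall2022, §2.2 ("`P(√(A†A)) = a_0 I + a_2 A†A + ⋯ + a_{2d}(A†A)^d`") and §4.2
proof of Theorem 4 ("Let `P` denote the polynomial from Lemma 4")] -/
def evenCoeffs (P : ℝ[X]) (d : ℕ) : Fin (d + 1) → ℝ := fun k => P.coeff (2 * (k : ℕ))

/-- For an even `P` of degree `≤ 2d+1`, `evenPolyVal (evenCoeffs P d) (x²) = P(x)`: the value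
`P̃(y) = ∑_{k≤d} a_k y^k` of `SparseQSVTEstimation.lean` at `y = x²` is `P(x)`.
[cite: GharibianLegall2022, §2.2 (even polynomials `P = ∑_k a_{2k} x^{2k}`)] -/
theorem evenPolyVal_evenCoeffs_sq (P : ℝ[X]) (hP : P.comp (-X) = P) {d : ℕ}
    (hd : P.natDegree ≤ 2 * d + 1) (x : ℝ) :
    evenPolyVal (evenCoeffs P d) (x ^ 2) = P.eval x := by
  have hfin : evenPolyVal (evenCoeffs P d) (x ^ 2) =
      ∑ k ∈ range (d + 1), P.coeff (2 * k) * (x ^ 2) ^ k := by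
    unfold evenPolyVal evenCoeffs
    exact Fin.sum_univ_eq_sum_range (fun k => P.coeff (2 * k) * (x ^ 2) ^ k) (d + 1)
  rw [hfin, eval_eq_sum_range' (n := 2 * (d + 1)) (by omega), sum_range_two_mul]
  refine Finset.sum_congr rfl fun k _ => ?_
  rw [coeff_odd_eq_zero hP k, zero_mul, add_zero, ← pow_mul]

/-- For an even `P` of degree `≤ 2d+1` and `y ≥ 0`, `evenPolyVal (evenCoeffs P d) y = P(√y)`.
[cite: GharibianLegall2022, §2.2 and §4.2 proof of Theorem 4 ("`P(σ_i)`" with `σ_i² =` the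
eigenvalues of `A†A`)] -/
theorem evenPolyVal_evenCoeffs (P : ℝ[X]) (hP : P.comp (-X) = P) {d : ℕ}
    (hd : P.natDegree ≤ 2 * d + 1) {y : ℝ} (hy : 0 ≤ y) :
    evenPolyVal (evenCoeffs P d) y = P.eval (Real.sqrt y) := by
  rw [← evenPolyVal_evenCoeffs_sq P hP hd (Real.sqrt y), Real.sq_sqrt hy]

/-- **The three Lemma-4 hypotheses of the in-tree Theorem 4, discharged.**  With
`P = windowPoly t₁ t₂ θ₁ θ₂ (2χ/5) P₁' P₂'`, `a = evenCoeffs P d` (`2d+1 ≥ max deg Pᵢ'`):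
`P̃ ∈ [0,1]` on `[0,1]`; `P̃(y) ≥ 1−χ` when `√y ∈ [t₁,t₂]`; `P̃(y) ≤ χ` when
`√y ∈ [0,t₁−θ₁] ∪ [t₂+θ₂,1]` — exactly `hP01`, `hPin`, `hPout` of `singularValue_decision` for
`χ = δ²/3`. [cite: GharibianLegall2022, §4.2 proof of Theorem 4 ("Let `P` denote the polynomial
from Lemma 4 for the value `χ = δ²/3`")] -/
theorem windowPoly_lemma4_hypotheses {t₁ t₂ θ₁ θ₂ χ : ℝ} {p₁ p₂ : ℝ[X]}
    (H : WindowHyp t₁ t₂ θ₁ θ₂ (2 * χ / 5) p₁ p₂) {d : ℕ}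
    (hd : max p₁.natDegree p₂.natDegree ≤ 2 * d + 1) :
    (∀ y : ℝ, 0 ≤ y → y ≤ 1 →
        0 ≤ evenPolyVal (evenCoeffs (windowPoly t₁ t₂ θ₁ θ₂ (2 * χ / 5) p₁ p₂) d) y ∧
          evenPolyVal (evenCoeffs (windowPoly t₁ t₂ θ₁ θ₂ (2 * χ / 5) p₁ p₂) d) y ≤ 1) ∧
      (∀ y : ℝ, 0 ≤ y → y ≤ 1 → t₁ ≤ Real.sqrt y → Real.sqrt y ≤ t₂ →
        1 - χ ≤ evenPolyVal (evenCoeffs (windowPoly t₁ t₂ θ₁ θ₂ (2 * χ / 5) p₁ p₂) d) y) ∧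
      (∀ y : ℝ, 0 ≤ y → y ≤ 1 → (Real.sqrt y ≤ t₁ - θ₁ ∨ t₂ + θ₂ ≤ Real.sqrt y) →
        evenPolyVal (evenCoeffs (windowPoly t₁ t₂ θ₁ θ₂ (2 * χ / 5) p₁ p₂) d) y ≤ χ) := by
  set P := windowPoly t₁ t₂ θ₁ θ₂ (2 * χ / 5) p₁ p₂ with hP_def
  have hPev : P.comp (-X) = P := windowPoly_comp_neg_X _ _ _ _ _ _ _
  have hPd : P.natDegree ≤ 2 * d + 1 := (natDegree_windowPoly_le _ _ _ _ _ _ _).trans hd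
  have hsq : ∀ y : ℝ, 0 ≤ y → y ≤ 1 → 0 ≤ Real.sqrt y ∧ Real.sqrt y ≤ 1 := fun y _ hy1 =>
    ⟨Real.sqrt_nonneg y, Real.sqrt_le_one.mpr hy1⟩
  have hχ : 0 ≤ χ := by linarith [H.hξ]
  refine ⟨fun y hy0 hy1 => ?_, fun y hy0 hy1 h1 h2 => ?_, fun y hy0 hy1 h => ?_⟩
  · rw [evenPolyVal_evenCoeffs P hPev hPd hy0]
    exact H.windowPoly_mem_Icc (by linarith [(hsq y hy0 hy1).1]) (hsq y hy0 hy1).2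
  · rw [evenPolyVal_evenCoeffs P hPev hPd hy0]
    have := H.windowPoly_ge_of_mem h1 h2
    linarith
  · rw [evenPolyVal_evenCoeffs P hPev hPd hy0]
    have hx : (0 ≤ Real.sqrt y ∧ Real.sqrt y ≤ t₁ - θ₁) ∨
        (t₂ + θ₂ ≤ Real.sqrt y ∧ Real.sqrt y ≤ 1) := by
      rcases h with h | h
      · exact Or.inl ⟨(hsq y hy0 hy1).1, h⟩
      · exact Or.inr ⟨h, (hsq y hy0 hy1).2⟩
    have := H.windowPoly_le_of_out hx
    linarith

/-- **GL22 Theorem 4 (formal version), real case, with Lemma 4 plugged in** — the decision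
procedure `SV(s,t₁,t₂,θ₁,θ₂,δ,ζ)` of `singularValue_decision` run with the Lemma-4 polynomial
`P = windowPoly t₁ t₂ θ₁ θ₂ (2χ/5) P₁' P₂'`, `χ = δ²/3`, read as the coefficient vector
`a = evenCoeffs P d` (`2d+1 ≥ max deg Pᵢ'`; the per-entry query count of Lemma 3 is then
`∑_{k≤d} s^{2k}` with `d = O((1/θ₁+1/θ₂)log(√3/δ))` by the cited degree bounds): in case (i)
(a singular value in `[t₁,t₂]` carrying weight `≥ δ²` of `u`) the answer "≤ δ²/2" has weight
`≤ η`, in case (ii) (no singular value in `(t₁−θ₁,t₂+θ₂)`) the answer "> δ²/2" has weight `≤ η`.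
The remaining hypotheses are the printed inputs (Def.-2 oracles of an `s`-sparse `A` with
`‖A‖ ≤ 1`, `ζ`-sampling access to `u` with `‖u‖ ≤ 1`, `ζ ≤ δ²/56`) and two sign polynomials of
[LowChuang2017] / [GilyenEtAl2019, Lemma 25] with `η = θᵢ/2`, `ξ = 2χ/5`.
[cite: GharibianLegall2022, §4.2 Theorem 4 (formal version) and its proof ("Let `P` denote the
polynomial from Lemma 4 for the value `χ = δ²/3` … Using the algorithm `EST(s,ε,ζ)` on input
`(A,u,u,P)` with `ε = δ²/7`")] -/
theorem singularValue_decision_of_signApprox {M N s d : ℕ} (A : Matrix (Fin M) (Fin N) ℝ)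
    (u : Fin N → ℝ) {rowO : SparseQuery.RowOracle (Fin M) (Fin N) ℝ}
    {colO : SparseQuery.RowOracle (Fin N) (Fin M) ℝ} (hr : rowO.Lists A) (hc : colO.Lists Aᵀ)
    (hrw : rowO.Width s) (hcw : colO.Width s) {ζ : ℝ} (S : ZetaSampling ζ u) (h0 : 0 ≤ ζ)
    {δ t₁ t₂ θ₁ θ₂ : ℝ} (hδ : 0 < δ) (hδ1 : δ ≤ 1) (hζ : ζ ≤ δ ^ 2 / 56)
    (hA : ∀ x : Fin N → ℝ, normSq (A *ᵥ x) ≤ normSq x) (hu : normSq u ≤ 1)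
    {p₁ p₂ : ℝ[X]} (H : WindowHyp t₁ t₂ θ₁ θ₂ (2 * (δ ^ 2 / 3) / 5) p₁ p₂)
    (hd : max p₁.natDegree p₂.natDegree ≤ 2 * d + 1)
    {η : ℝ} (hη : 0 < η) {x q : ℕ} (hx : 1024 / (δ ^ 2 / 7) ^ 2 ≤ (x : ℝ)) (hq : 0 < q)
    (hqη : 8 * Real.log (1 / η) ≤ q) (med : (Fin q → Fin x → Fin N) → ℝ)
    (hmed : ∀ ω, IsMedian
      (fun i => blockMean (S.est (SparseQuery.recEvalPoly
        (evenCoeffs (windowPoly t₁ t₂ θ₁ θ₂ (2 * (δ ^ 2 / 3) / 5) p₁ p₂) d)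
        (rowO.gram colO) u)) (ω i)) (med ω)) :
    ((δ ^ 2 ≤ ∑ i ∈ univ.filter (fun i => t₁ ≤ Real.sqrt (singularValueSq A i) ∧
          Real.sqrt (singularValueSq A i) ≤ t₂), singularCoeff A u i ^ 2) →
      ∑ ω ∈ univ.filter (fun ω : Fin q → Fin x → Fin N => med ω ≤ δ ^ 2 / 2),
        ∏ i, iidWeight S.p (ω i) ≤ η)
    ∧ ((∀ i, ¬ (t₁ - θ₁ < Real.sqrt (singularValueSq A i) ∧
          Real.sqrt (singularValueSq A i) < t₂ + θ₂)) →
      ∑ ω ∈ univ.filter (fun ω : Fin q → Fin x → Fin N => δ ^ 2 / 2 < med ω),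
        ∏ i, iidWeight S.p (ω i) ≤ η) := by
  obtain ⟨hP01, hPin, hPout⟩ := windowPoly_lemma4_hypotheses H hd
  exact singularValue_decision A _ u hr hc hrw hcw S h0 hδ hδ1 hζ hA hu hP01 hPin hPout hη hx hq
    hqη med hmed

/-! ### [GSLW19] Lemma 29 (arXiv:1806.01838 Lemma 28): the symmetric rectangle polynomial

> **Lemma 28 (Polynomial approximations of the rectangle function).** Let `δ', ε' ∈ (0, 1/2)`
> and `t ∈ [−1,1]`. There exist an even polynomial `P' ∈ ℝ[x]` of degree `O(log(1/ε')/δ')`,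
> such that `|P'(x)| ≤ 1` for all `x ∈ [−1,1]`, and `P'(x) ∈ [0,ε']` for all
> `x ∈ [−1,−t−δ'] ∪ [t+δ',1]`, and `P'(x) ∈ [1−ε',1]` for all `x ∈ [−t+δ', t−δ']`.
>
> *Proof.* First let us take a real polynomial `P` which `ε'/2`-approximates the sign function
> on the interval `[−2,2] \ (−δ',δ')`, moreover for all `x ∈ [−2,2]: |P(x)| ≤ 1`. Such a
> polynomial of degree `O(log(1/ε')/δ')` can be efficiently constructed by Lemma 25 [arXiv:
> Lemma 24]. Now take the polynomial `P'(x) := (1−ε')(P(x+t)+P(−x+t))/2 + ε'`. It is easy to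
> see that by construction `P'(x)` is an even polynomial of degree `O(log(1/ε')/δ')`. Moreover
> `|P'(x)| ≤ 1` for all `x ∈ [−1,1]` and (30) also holds.

Transcription note [R-RP-2]: the held arXiv TeX source carries the unresolved cross-reference
labels `Lemma~\ref{lemma:signApx}` and `(\ref{eq:polyRect})` in this proof; they are rendered
above EDITORIALLY as "Lemma 25 [arXiv: Lemma 24]" (the sign-polynomial lemma, numbering of the
STOC version / of arXiv:1806.01838) and "(30)" (the two-line display of the lemma's range
conditions, numbering of the STOC version).  Nothing else in the quotation is altered.

The sign-polynomial input is again the hypothesis class `SignApprox δ' ξ P` (`ξ = ε'/2`).  As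
for Lemma 4 above, the printed affine normalisation `S ↦ (1−ε')S/2 + ε'` over-shoots on the
outer region (values up to `ε'(5−ε')/4 > ε'`, module docstring), so `rectPoly` uses
`S ↦ (S + ξ)/(2 + ξ)`, which yields every printed inclusion (`rectPoly_abs_le`,
`rectPoly_outer`: `P' ∈ [0, ξ] ⊆ [0, ε']`, `rectPoly_inner`: `P' ∈ [1 − ξ, 1] ⊆ [1 − ε', 1]`).
The print's `t ∈ [−1,1]` enters as `0 ≤ t ≤ 1`: the construction uses
`x ≥ t + δ' ⇒ x + t ≥ δ'`, i.e. `t ≥ 0` (for `t < 0` — a case not used in [GilyenEtAl2019],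
whose applications take `t = (1−δ/2)/γ`, `3δ/4`, … > 0 — the inner interval is empty and the
constant `ε'/2` satisfies the statement trivially, while the printed `P'` does not: at `x = 0`,
`t ≤ −δ'` it equals `(1−ε')P(t) + ε' ≤ (1−ε')(−1+ε'/2) + ε' < 0` for small `ε'`).  `rectPoly`
is the special case `windowQ (−t) t 0 0 ξ P P` of GL22's `Q` (`rectPoly_eq_windowQ`) — GL22's
remark that Lemma 4 "can be considered as a variant of Lemma 29 in [Gilyen+STOC19]". -/

section gslwRectangle

variable (t ξ : ℝ) (p : ℝ[X])

/-- **`P'`** of [GSLW19] Lemma 29 with the corrected affine map: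
`P'(x) = (P(x+t) + P(−x+t) + ξ)/(2+ξ)`, `ξ = ε'/2` (in print `(1−ε')(P(x+t)+P(−x+t))/2 + ε'`).
[cite: GilyenEtAl2019, Lemma 29 (arXiv:1806.01838 Lemma 28), proof (definition of `P'`)] -/
def rectPoly : ℝ[X] := C (1 / (2 + ξ)) * (p.comp (X + C t) + p.comp (C t - X) + C ξ)

/-- Pointwise value `P'(x) = (P(x+t) + P(t−x) + ξ)/(2+ξ)`.
[cite: GilyenEtAl2019, Lemma 29 (arXiv:1806.01838 Lemma 28), proof] -/
theorem eval_rectPoly (x : ℝ) :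
    (rectPoly t ξ p).eval x = (p.eval (x + t) + p.eval (t - x) + ξ) / (2 + ξ) := by
  simp only [rectPoly, eval_mul, eval_C, eval_add, eval_comp, eval_sub, eval_X]
  ring

/-- `P'` is GL22's `Q` for the symmetric window `[−t, t]` with `θ₁ = θ₂ = 0`:
`rectPoly t ξ P = windowQ (−t) t 0 0 ξ P P`. [cite: GharibianLegall2022, §4.2 (Lemma 4 "can be
considered as a variant of Lemma 29 in [Gilyen+STOC19]")] -/
theorem rectPoly_eq_windowQ : rectPoly t ξ p = windowQ (-t) t 0 0 ξ p p := by
  simp only [rectPoly, windowQ, zero_div, sub_zero, add_zero, map_neg, sub_neg_eq_add]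

/-- **`P'` is even**: `P'(−X) = P'`. [cite: GilyenEtAl2019, Lemma 29 (arXiv:1806.01838
Lemma 28) ("an even polynomial"; proof: "by construction `P'(x)` is an even polynomial")] -/
theorem rectPoly_comp_neg_X : (rectPoly t ξ p).comp (-X) = rectPoly t ξ p := by
  have h1 : (X + C t : ℝ[X]).comp (-X) = C t - X := by
    simp only [add_comp, X_comp, C_comp]; ring
  have h2 : (C t - X : ℝ[X]).comp (-X) = X + C t := by
    simp only [sub_comp, X_comp, C_comp]; ring
  simp only [rectPoly, mul_comp, C_comp, add_comp, comp_assoc, h1, h2]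
  ring

/-- **Degree**: `deg P' ≤ deg P` (with the cited `deg P = O(log(1/ε')/δ')` this is the printed
degree of `P'`). [cite: GilyenEtAl2019, Lemma 29 (arXiv:1806.01838 Lemma 28) (degree
`O(log(1/ε')/δ')`)] -/
theorem natDegree_rectPoly_le : (rectPoly t ξ p).natDegree ≤ p.natDegree := by
  rw [rectPoly_eq_windowQ]
  exact (natDegree_windowQ_le _ _ _ _ _ _ _).trans (max_self _).le

variable {t ξ p} {δ' : ℝ}

/-- **`|P'(x)| ≤ 1` for all `x ∈ [−1,1]`** (indeed `P'(x) ∈ [(ξ−2)/(ξ+2), 1]`; only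
`t ∈ [−1,1]` and `|P| ≤ 1` on `[−2,2]` are used). [cite: GilyenEtAl2019, Lemma 29
(arXiv:1806.01838 Lemma 28) ("`|P'(x)| ≤ 1` for all `x ∈ [−1,1]`")] -/
theorem rectPoly_abs_le (h : SignApprox δ' ξ p) (hξ : 0 ≤ ξ) (ht0 : -1 ≤ t) (ht1 : t ≤ 1)
    {x : ℝ} (hx1 : -1 ≤ x) (hx2 : x ≤ 1) : |(rectPoly t ξ p).eval x| ≤ 1 := by
  rw [eval_rectPoly]
  have h2 : 0 < 2 + ξ := by linarith
  have ha1 := h.neg_one_le (x := x + t) (by linarith) (by linarith)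
  have ha2 := h.le_one (x := x + t) (by linarith) (by linarith)
  have hb1 := h.neg_one_le (x := t - x) (by linarith) (by linarith)
  have hb2 := h.le_one (x := t - x) (by linarith) (by linarith)
  rw [abs_le, le_div_iff₀ h2, div_le_iff₀ h2]
  constructor <;> linarith

/-- **Outer region: `P'(x) ∈ [0, ε']` for all `x ∈ [−1,−t−δ'] ∪ [t+δ',1]`** — indeed
`P'(x) ∈ [0, 2ξ/(2+ξ)] ⊆ [0, ξ]`, `ξ = ε'/2` (there one of `P(x+t)`, `P(t−x)` is pinned in
`[1−ξ,1]` and the other in `[−1,−1+ξ]`; uses `0 ≤ t ≤ 1` and `0 ≤ δ'`, module note above).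
[cite: GilyenEtAl2019, Lemma 29 (arXiv:1806.01838 Lemma 28), display (30) first line] -/
theorem rectPoly_outer (h : SignApprox δ' ξ p) (hξ : 0 ≤ ξ) (hδ : 0 ≤ δ') (ht0 : 0 ≤ t)
    (ht1 : t ≤ 1) {x : ℝ} (hx : (-1 ≤ x ∧ x ≤ -t - δ') ∨ (t + δ' ≤ x ∧ x ≤ 1)) :
    0 ≤ (rectPoly t ξ p).eval x ∧ (rectPoly t ξ p).eval x ≤ ξ := by
  rw [eval_rectPoly]
  have h2 : 0 < 2 + ξ := by linarith
  have hS : 0 ≤ p.eval (x + t) + p.eval (t - x) + ξ ∧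
      p.eval (x + t) + p.eval (t - x) + ξ ≤ 2 * ξ := by
    rcases hx with ⟨hx1, hx2⟩ | ⟨hx1, hx2⟩
    · have ha1 := h.neg_one_le (x := x + t) (by linarith) (by linarith)
      have ha2 := h.le_on_neg (x + t) (by linarith) (by linarith)
      have hb1 := h.ge_on_pos (t - x) (by linarith) (by linarith)
      have hb2 := h.le_one (x := t - x) (by linarith) (by linarith)
      constructor <;> linarith
    · have ha1 := h.ge_on_pos (x + t) (by linarith) (by linarith)
      have ha2 := h.le_one (x := x + t) (by linarith) (by linarith)
      have hb1 := h.neg_one_le (x := t - x) (by linarith) (by linarith)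
      have hb2 := h.le_on_neg (t - x) (by linarith) (by linarith)
      constructor <;> linarith
  refine ⟨div_nonneg hS.1 h2.le, ?_⟩
  rw [div_le_iff₀ h2]
  nlinarith [mul_nonneg hξ hξ, hS.2]

/-- **Inner region: `P'(x) ∈ [1−ε', 1]` for all `x ∈ [−t+δ', t−δ']`** — indeed
`P'(x) ∈ [(2−ξ)/(2+ξ), 1] ⊆ [1−ξ, 1]`, `ξ = ε'/2` (both `P(x+t)`, `P(t−x)` are pinned in
`[1−ξ,1]`). [cite: GilyenEtAl2019, Lemma 29 (arXiv:1806.01838 Lemma 28), display (30) second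
line] -/
theorem rectPoly_inner (h : SignApprox δ' ξ p) (hξ : 0 ≤ ξ) (hδ : 0 ≤ δ') (ht1 : t ≤ 1)
    {x : ℝ} (hx1 : -t + δ' ≤ x) (hx2 : x ≤ t - δ') :
    1 - ξ ≤ (rectPoly t ξ p).eval x ∧ (rectPoly t ξ p).eval x ≤ 1 := by
  rw [eval_rectPoly]
  have h2 : 0 < 2 + ξ := by linarith
  have ha1 := h.ge_on_pos (x + t) (by linarith) (by linarith)
  have ha2 := h.le_one (x := x + t) (by linarith) (by linarith)
  have hb1 := h.ge_on_pos (t - x) (by linarith) (by linarith)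
  have hb2 := h.le_one (x := t - x) (by linarith) (by linarith)
  rw [le_div_iff₀ h2, div_le_iff₀ h2]
  constructor <;> nlinarith [mul_nonneg hξ hξ]

/-- **[GSLW19] Lemma 29 assembled, as printed** (`ξ = ε'/2`, `t ∈ [0,1]`, module note): from a
sign polynomial `P` with `SignApprox δ' (ε'/2) P`, the polynomial `P' = rectPoly t (ε'/2) P`
is even, has `deg P' ≤ deg P`, `|P'(x)| ≤ 1` on `[−1,1]`, `P'(x) ∈ [0,ε']` on
`[−1,−t−δ'] ∪ [t+δ',1]` and `P'(x) ∈ [1−ε',1]` on `[−t+δ',t−δ']`.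
[cite: GilyenEtAl2019, Lemma 29 (arXiv:1806.01838 Lemma 28)] -/
theorem rectPoly_spec {t δ' ε' : ℝ} {p : ℝ[X]} (h : SignApprox δ' (ε' / 2) p) (hε : 0 ≤ ε')
    (hδ : 0 ≤ δ') (ht0 : 0 ≤ t) (ht1 : t ≤ 1) :
    (rectPoly t (ε' / 2) p).comp (-X) = rectPoly t (ε' / 2) p ∧
    (rectPoly t (ε' / 2) p).natDegree ≤ p.natDegree ∧
    (∀ x : ℝ, -1 ≤ x → x ≤ 1 → |(rectPoly t (ε' / 2) p).eval x| ≤ 1) ∧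
    (∀ x : ℝ, (-1 ≤ x ∧ x ≤ -t - δ') ∨ (t + δ' ≤ x ∧ x ≤ 1) →
      0 ≤ (rectPoly t (ε' / 2) p).eval x ∧ (rectPoly t (ε' / 2) p).eval x ≤ ε') ∧
    (∀ x : ℝ, -t + δ' ≤ x → x ≤ t - δ' →
      1 - ε' ≤ (rectPoly t (ε' / 2) p).eval x ∧ (rectPoly t (ε' / 2) p).eval x ≤ 1) := by
  have hξ : 0 ≤ ε' / 2 := by linarith
  refine ⟨rectPoly_comp_neg_X _ _ _, natDegree_rectPoly_le _ _ _,
    fun x hx1 hx2 => rectPoly_abs_le h hξ (by linarith) ht1 hx1 hx2, fun x hx => ?_,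
    fun x hx1 hx2 => ?_⟩
  · have := rectPoly_outer h hξ hδ ht0 ht1 hx
    exact ⟨this.1, by linarith [this.2]⟩
  · have := rectPoly_inner h hξ hδ ht1 hx1 hx2
    exact ⟨by linarith [this.1], this.2⟩

/-- **Existence form of [GSLW19] Lemma 29** (WITHOUT the degree bound, from the non-vacuity
`SignApprox.exists_of_pos`; `t ∈ [0,1]`, `δ' > 0`, `ε' ∈ (0,2]`): an even real polynomial with
`|P'| ≤ 1` on `[−1,1]`, `P' ∈ [0,ε']` on `[−1,−t−δ'] ∪ [t+δ',1]`, `P' ∈ [1−ε',1]` on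
`[−t+δ',t−δ']`.  The printed degree `O(log(1/ε')/δ')` is `natDegree_rectPoly_le` combined with
the cited sign-polynomial degree (an explicit member: `Summits/…/Dequantization/SignPolynomial`).
[cite: GilyenEtAl2019, Lemma 29 (arXiv:1806.01838 Lemma 28)] -/
theorem exists_even_rectangle {t δ' ε' : ℝ} (hδ : 0 < δ') (hε : 0 < ε') (hε1 : ε' ≤ 2)
    (ht0 : 0 ≤ t) (ht1 : t ≤ 1) :
    ∃ P : ℝ[X], P.comp (-X) = P ∧ (∀ x : ℝ, -1 ≤ x → x ≤ 1 → |P.eval x| ≤ 1) ∧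
      (∀ x : ℝ, (-1 ≤ x ∧ x ≤ -t - δ') ∨ (t + δ' ≤ x ∧ x ≤ 1) →
        0 ≤ P.eval x ∧ P.eval x ≤ ε') ∧
      (∀ x : ℝ, -t + δ' ≤ x → x ≤ t - δ' → 1 - ε' ≤ P.eval x ∧ P.eval x ≤ 1) := by
  obtain ⟨p, hp⟩ := SignApprox.exists_of_pos hδ (by linarith : 0 < ε' / 2) (by linarith)
  obtain ⟨h1, -, h3, h4, h5⟩ := rectPoly_spec hp hε.le hδ.le ht0 ht1
  exact ⟨_, h1, h3, h4, h5⟩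

end gslwRectangle

end SampleQuery

end Literature.Computability.QuantumComplexity

end
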